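import Summits.Parity.GeneralizedHardyLittlewood.Theorems.LeeYangFibresCellParityLawP2Defs
import Summits.Parity.GeneralizedHardyLittlewood.Theorems.LeeYangFibresCellParityLawGeThreeReduce
import HarnessLib

/-!
# Route `LeeYangFibres`, crux `CellParityLaw` (stmt-Parity-14109), line `section-annihilator`:
# the registered stub `stub_geThreeReduceStrong` — the strong kernel applied

Skeleton v18 (lead c5). This file proves the glue statement (vocabulary file `LeeYangFibresCellParityLawP2Defs`)

  `GeThreeReduceStrong : CoveringInequality → EffectiveRoughCellLawStrong →
     (∀ t ≥ 1, SectionLevelAt t → KernelReadyAt t) → ∀ t ≥ 1, SectionLevelAt t → RawSectionLawAt t`,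

the analogue of the landed `stub_geThreeReduce` (`LeeYangFibresCellParityLawGeThreeReduce`) with the reshaped kernel
`EffectiveRoughCellLawStrong` (thresholds `z ≤ x^{1/2}`, no size lower bound, an explicit junk term `x/z` in the
error, Type-I hypothesis in the STRONG shape `Σ_d sup_{y ≤ x} |r_d(y)|` = `StrongTypeI`) in place of
`EffectiveRoughCellLaw`. The proof is the template's, with three additions:

* the ready section sequence (`KernelReadyAt`, two instances for the same data exactly as in the template: one at
  `(A, B₂) = (0, 1)` for the density constant `L'₀`, one at the working `(A, B₂)`) supplies the body-by-body Type-I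
  bound `R = N/(log N)^A` for EVERY `A`; the covering inequality on the grid `Y = (log N)^P` converts it into the
  strong bound `R_s = ((log N)^P + 2) R + C_c (x/(log N)^P + x^{1-η}) (log x)^{A₃}`; we take `Q = A₂ + t + 3`,
  `P = A₃ + Q + 1`, `A = P + Q`;
* `η = 2(log log N)^{-B₂} ≤ η₀` eventually (`GeThreeReduceStrongAux.eventually_eta_le`);
* the absolute error `C (log x)^{A₂} (R_s + x/z)` is `≤ N/(log N)^{t+2}` for `N ≥ N₀`: with `ℓ = log N`,
  `log x ≤ 2ℓ`, `x^{1-η} ≤ N/ℓ^{A₃+Q}` (`GeThreeReduceStrongAux.eventually_x_rpow_le`: `log(2L) + (A₃+Q) log ℓ ≤ η ℓ`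
  because `log N/(log log N)^{B₂+1} → ∞`) and `x/z = 2LN^{1-1/u} ≤ N/ℓ^Q`
  (`GeThreeReduceStrongAux.eventually_x_div_z_le`), the pointwise bookkeeping
  `GeThreeReduceStrongAux.strong_R_le` gives `R_s + x/z ≤ c₁ N/ℓ^Q`, `c₁ = 4 + C_c 2^{A₃} (2L+1)`, and the
  template's `eventually_R_term` (constant `C c₁`) finishes.

The relative error terms `C η^κ`, `C (log z)^{-κ}`, `C log(2Λ)/log z` are handled verbatim by the template's
`GeThreeReduceAux` lemmas. No published fact is used; nothing here is specific to the kernel's truth.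

References: E. Bombieri, RIMS Kôkyûroku 294 (1977) p. 5 [BombieriRIMS1977]; E. Bombieri, J. Friedlander,
H. Iwaniec, Acta Math. 156 (1986), hypothesis (A₂) [BombieriFriedlanderIwaniecActa1986].
-/

noncomputable section

open scoped BigOperators Topology Classical
open Finset Filter Literature.NumberTheory.Sieve

namespace Summit.Parity.GeneralizedHardyLittlewood.Cruxes.CellParityLaw.SectionAnnihilator

namespace GeThreeReduceStrongAux

/-- Eventually `η = 2/(log log N)^{B₂} ≤ η₀` (`B₂ ≥ 1`, `η₀ > 0`): `(log log N)^{B₂} ≥ log log N ≥ 2/η₀`. -/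
theorem eventually_eta_le {B₂ : ℕ} (hB₂ : 1 ≤ B₂) {η₀ : ℝ} (hη₀ : 0 < η₀) :
    ∀ᶠ N : ℕ in atTop, etaOf N B₂ ≤ η₀ := by
  filter_upwards [PrLawTwoAssemblyAux.eventually_le_loglog (max 1 (2 / η₀))] with N hN
  set ℓℓ := Real.log (Real.log (N : ℝ)) with hℓℓ
  have h1 : 1 ≤ ℓℓ := le_trans (le_max_left _ _) hN
  have h2 : 2 / η₀ ≤ ℓℓ ^ B₂ := (le_trans (le_max_right _ _) hN).trans (le_self_pow₀ h1 (by omega))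
  have hpos : 0 < ℓℓ ^ B₂ := pow_pos (by linarith) _
  change 2 / ℓℓ ^ B₂ ≤ η₀
  rw [div_le_iff₀ hpos]
  rw [div_le_iff₀ hη₀] at h2
  linarith [mul_comm η₀ (ℓℓ ^ B₂)]

/-- Eventually `x^{1-η} = (2LN)^{1 - 2(log log N)^{-B₂}} ≤ N/(log N)^Q` (`L ≥ 1`; every `Q`): comparing
logarithms, this is `log(2L) + Q log log N ≤ η log(2LN)`, and `η log N = 2 log N/(log log N)^{B₂}` exceeds
`(Q+1)(log log N)` eventually. -/
theorem eventually_x_rpow_le (L B₂ Q : ℕ) (hL : 1 ≤ L) :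
    ∀ᶠ N : ℕ in atTop, (2 * (L : ℝ) * N) ^ (1 - etaOf N B₂) ≤ (N : ℝ) / Real.log N ^ Q := by
  have hL1 : (1 : ℝ) ≤ L := by exact_mod_cast hL
  filter_upwards [PrLawTwoAssemblyAux.eventually_const_mul_loglog_pow_le (B₂ + 1) ((Q : ℝ) + 1)
      (by positivity), PrLawTwoAssemblyAux.eventually_le_loglog (max 1 (Real.log (2 * L))),
    (Real.tendsto_log_atTop.comp tendsto_natCast_atTop_atTop).eventually_ge_atTop (1 : ℝ),
    eventually_ge_atTop 1] with N hN hll hl1 hN1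
  have hl1' : (1 : ℝ) ≤ Real.log (N : ℝ) := hl1
  have hN0 : (0 : ℝ) < N := by exact_mod_cast hN1
  set ℓ := Real.log (N : ℝ) with hℓ
  set ℓℓ := Real.log ℓ with hℓℓ
  have hℓℓ1 : 1 ≤ ℓℓ := le_trans (le_max_left _ _) hll
  have hℓℓL : Real.log (2 * L) ≤ ℓℓ := le_trans (le_max_right _ _) hll
  have hℓ0 : 0 < ℓ := by linarith
  have hx0 : 0 < 2 * (L : ℝ) * N := by positivity
  have hpow : 0 < ℓℓ ^ B₂ := pow_pos (by linarith) _
  have hη : etaOf N B₂ = 2 / ℓℓ ^ B₂ := rfl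
  have hη0 : 0 ≤ etaOf N B₂ := by rw [hη]; exact div_nonneg zero_le_two hpow.le
  have hlog2L : 0 ≤ Real.log (2 * L) := Real.log_nonneg (by linarith)
  -- the key inequality `log(2L) + Q log log N ≤ η log N`
  have hkey : Real.log (2 * L) + Q * ℓℓ ≤ etaOf N B₂ * ℓ := by
    rw [hη, div_mul_eq_mul_div, le_div_iff₀ hpow]
    calc (Real.log (2 * L) + Q * ℓℓ) * ℓℓ ^ B₂ ≤ (ℓℓ + Q * ℓℓ) * ℓℓ ^ B₂ := by gcongr
      _ = ((Q : ℝ) + 1) * ℓℓ ^ (B₂ + 1) := by ring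
      _ ≤ ℓ := hN
      _ ≤ 2 * ℓ := by linarith
  -- compare logarithms
  rw [← Real.log_le_log_iff (Real.rpow_pos_of_pos hx0 _) (by positivity), Real.log_rpow hx0,
    Real.log_div hN0.ne' (pow_pos hℓ0 _).ne', Real.log_pow, Real.log_mul (by positivity) hN0.ne', ← hℓ,
    ← hℓℓ]
  nlinarith [mul_nonneg hη0 hlog2L]

/-- Eventually `x/z = 2LN/N^{1/u} ≤ N/(log N)^Q` (`L, u ≥ 1`; every `Q`): `2L (log N)^Q ≤ N^{1/u}` since
`log(2L) + Q log log N ≤ (Q+1) log log N ≤ (log N)/u` eventually. -/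
theorem eventually_x_div_z_le (L u Q : ℕ) (hL : 1 ≤ L) (hu : 1 ≤ u) :
    ∀ᶠ N : ℕ in atTop, 2 * (L : ℝ) * N / (N : ℝ) ^ ((1 : ℝ) / u) ≤ (N : ℝ) / Real.log N ^ Q := by
  have hL1 : (1 : ℝ) ≤ L := by exact_mod_cast hL
  have hu0 : (0 : ℝ) < u := by exact_mod_cast hu
  filter_upwards [PrLawTwoAssemblyAux.eventually_const_mul_loglog_pow_le 1 ((u : ℝ) * ((Q : ℝ) + 1))
      (by positivity), PrLawTwoAssemblyAux.eventually_le_loglog (max 1 (Real.log (2 * L))),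
    (Real.tendsto_log_atTop.comp tendsto_natCast_atTop_atTop).eventually_ge_atTop (1 : ℝ),
    eventually_ge_atTop 1] with N hN hll hl1 hN1
  have hl1' : (1 : ℝ) ≤ Real.log (N : ℝ) := hl1
  have hN0 : (0 : ℝ) < N := by exact_mod_cast hN1
  set ℓ := Real.log (N : ℝ) with hℓ
  set ℓℓ := Real.log ℓ with hℓℓ
  have hℓℓ1 : 1 ≤ ℓℓ := le_trans (le_max_left _ _) hll
  have hℓℓL : Real.log (2 * L) ≤ ℓℓ := le_trans (le_max_right _ _) hll
  have hℓ0 : 0 < ℓ := by linarith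
  -- `2L (log N)^Q ≤ N^{1/u}`
  have hz : 2 * (L : ℝ) * ℓ ^ Q ≤ (N : ℝ) ^ ((1 : ℝ) / u) := by
    rw [← Real.log_le_log_iff (by positivity) (Real.rpow_pos_of_pos hN0 _),
      Real.log_mul (by positivity) (pow_pos hℓ0 _).ne', Real.log_pow, Real.log_rpow hN0, ← hℓ, ← hℓℓ]
    have h : (Real.log (2 * L) + Q * ℓℓ) * u ≤ ℓ :=
      calc (Real.log (2 * L) + Q * ℓℓ) * u ≤ (ℓℓ + Q * ℓℓ) * u := by gcongr
        _ = (u : ℝ) * ((Q : ℝ) + 1) * ℓℓ ^ 1 := by ring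
        _ ≤ ℓ := hN
    rw [one_div, inv_mul_eq_div, le_div_iff₀ hu0]
    exact h
  calc 2 * (L : ℝ) * N / (N : ℝ) ^ ((1 : ℝ) / u)
      ≤ 2 * (L : ℝ) * N / (2 * (L : ℝ) * ℓ ^ Q) :=
        div_le_div_of_nonneg_left (by positivity) (by positivity) hz
    _ = (N : ℝ) / ℓ ^ Q := mul_div_mul_left _ _ (by positivity)

/-- Pointwise bookkeeping of the absolute error: with `ℓ ≥ 1`, `log x ≤ 2ℓ`, `x = 2LN`, `P = A₃ + Q + 1`,
`A = P + Q`, `x^{1-η} = S ≤ N/ℓ^{A₃+Q}` and `x/z ≤ N/ℓ^Q`,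
`(ℓ^P + 2) N/ℓ^A + C_c (x/ℓ^P + S)(log x)^{A₃} + x/z ≤ (4 + C_c 2^{A₃}(2L+1)) N/ℓ^Q`. -/
theorem strong_R_le {ℓ lx x N L Cc S xz : ℝ} {A₃ P Q A : ℕ} (hP : P = A₃ + Q + 1) (hA : A = P + Q)
    (hx : x = 2 * L * N) (hℓ : 1 ≤ ℓ) (hlx : lx ≤ 2 * ℓ) (hlx0 : 0 ≤ lx) (hN : 0 ≤ N) (hL : 0 ≤ L)
    (hCc : 0 ≤ Cc) (hS : S ≤ N / ℓ ^ (A₃ + Q)) (hxz : xz ≤ N / ℓ ^ Q) :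
    (ℓ ^ P + 2) * (N / ℓ ^ A) + Cc * (x / ℓ ^ P + S) * lx ^ A₃ + xz ≤
      (4 + Cc * 2 ^ A₃ * (2 * L + 1)) * (N / ℓ ^ Q) := by
  subst hA hP hx
  have hℓ0 : 0 < ℓ := by linarith
  have hP1 : 1 ≤ ℓ ^ (A₃ + Q + 1) := one_le_pow₀ hℓ
  have hℓP : 0 < ℓ ^ (A₃ + Q + 1) := by positivity
  -- the grid term `(ℓ^P + 2) R ≤ 3 N/ℓ^Q`
  have hT1 : (ℓ ^ (A₃ + Q + 1) + 2) * (N / ℓ ^ (A₃ + Q + 1 + Q)) ≤ 3 * (N / ℓ ^ Q) := by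
    rw [pow_add ℓ (A₃ + Q + 1) Q]
    calc (ℓ ^ (A₃ + Q + 1) + 2) * (N / (ℓ ^ (A₃ + Q + 1) * ℓ ^ Q))
        = (ℓ ^ (A₃ + Q + 1) + 2) / ℓ ^ (A₃ + Q + 1) * (N / ℓ ^ Q) := by
          rw [div_mul_div_comm, mul_div_assoc]
      _ ≤ 3 * (N / ℓ ^ Q) := by
          gcongr
          rw [div_le_iff₀ hℓP]
          linarith
  -- the covering junk `C_c (x/ℓ^P + x^{1-η}) (log x)^{A₃} ≤ C_c 2^{A₃} (2L+1) N/ℓ^Q`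
  have h1 : 2 * L * N / ℓ ^ (A₃ + Q + 1) ≤ 2 * L * N / ℓ ^ (A₃ + Q) :=
    div_le_div_of_nonneg_left (by positivity) (by positivity) (pow_le_pow_right₀ hℓ (by omega))
  have hT2 : Cc * (2 * L * N / ℓ ^ (A₃ + Q + 1) + S) * lx ^ A₃ ≤
      Cc * 2 ^ A₃ * (2 * L + 1) * (N / ℓ ^ Q) := by
    calc Cc * (2 * L * N / ℓ ^ (A₃ + Q + 1) + S) * lx ^ A₃
        ≤ Cc * (2 * L * N / ℓ ^ (A₃ + Q) + N / ℓ ^ (A₃ + Q)) * (2 * ℓ) ^ A₃ := by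
          gcongr Cc * (?_ + ?_) * ?_ ^ A₃
      _ = Cc * 2 ^ A₃ * (2 * L + 1) * (N / ℓ ^ Q) := by
          rw [pow_add, mul_pow]
          field_simp
  calc (ℓ ^ (A₃ + Q + 1) + 2) * (N / ℓ ^ (A₃ + Q + 1 + Q)) +
        Cc * (2 * L * N / ℓ ^ (A₃ + Q + 1) + S) * lx ^ A₃ + xz
      ≤ 3 * (N / ℓ ^ Q) + Cc * 2 ^ A₃ * (2 * L + 1) * (N / ℓ ^ Q) + N / ℓ ^ Q :=
        add_le_add_three hT1 hT2 hxz
    _ = (4 + Cc * 2 ^ A₃ * (2 * L + 1)) * (N / ℓ ^ Q) := by ring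

end GeThreeReduceStrongAux

open GeThreeReduceAux GeThreeReduceStrongAux PrLawTwoAssemblyAux in
/-- **`stub_geThreeReduceStrong`** (registered stub of skeleton v18, line `section-annihilator`): the strong kernel
applied, `GeThreeReduceStrong` — `EffectiveRoughCellLawStrong` at `(u, A₁ = t+2, L'₀)` for the ready section
sequence, with the strong Type-I bound supplied by `CoveringInequality` on the grid `Y = (log N)^{A₃+A₂+t+4}` from
the body-by-body bound `N/(log N)^{A₃+2A₂+2t+7}`, `B₂ = ⌈(Bκ+1)/κ⌉ + 1`; for `N ≥ N₀` the kernel's error is below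
`V F/(log log N)^{Bκ} + N/(log N)^{t+2}`. -/
theorem stub_geThreeReduceStrong : GeThreeReduceStrong := by
  intro hCov hK hHyp t ht hA L u Bκ hu
  have hR := hHyp t ht hA
  -- the vacuous case `L = 0`
  rcases Nat.eq_zero_or_pos L with hL0 | hLpos
  · refine ⟨0, fun N _ Ψ hΨ hL K _ _ i => ?_⟩
    have h1 : (1 : ℝ) ≤ (L : ℝ) := one_le_of_affLinSize_le Ψ hΨ hL i
    rw [hL0, Nat.cast_zero] at h1
    exact absurd h1 (by norm_num)
  have hL1 : 1 ≤ L := hLpos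
  have hL1r : (1 : ℝ) ≤ L := by exact_mod_cast hL1
  have hu1 : 1 ≤ u := by omega
  -- the density constant `L'₀` (instance `A = 0`, `B₂ = 1`), the kernel's and the covering constants
  obtain ⟨L'₀, M₀, h0⟩ := hR L u 0 1 hu le_rfl
  obtain ⟨κ, C, η₀, A₂, x₀, hκ, hC, hη₀, hKer⟩ := hK u ((t : ℝ) + 2) L'₀ hu
  obtain ⟨Cc, A₃, hCc, hcov⟩ := hCov ((t : ℝ) + 2) L'₀
  -- the working instance: `B₂ κ ≥ Bκ + 1`, `Q = A₂ + t + 3`, grid `Y = (log N)^P`, saving `A = P + Q`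
  set B₂ : ℕ := ⌈((Bκ : ℝ) + 1) / κ⌉₊ + 1 with hB₂
  have hB₂1 : 1 ≤ B₂ := by omega
  have hBκ : (Bκ : ℝ) + 1 ≤ (B₂ : ℝ) * κ := by
    have h1 : ((Bκ : ℝ) + 1) / κ ≤ ⌈((Bκ : ℝ) + 1) / κ⌉₊ := Nat.le_ceil _
    have h2 : ((Bκ : ℝ) + 1) / κ ≤ (B₂ : ℝ) := by rw [hB₂]; push_cast; linarith
    rwa [div_le_iff₀ hκ] at h2
  set Q : ℕ := A₂ + t + 3 with hQ
  set P : ℕ := A₃ + Q + 1 with hP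
  set A : ℕ := P + Q with hAdef
  set c₁ : ℝ := 4 + Cc * 2 ^ A₃ * (2 * (L : ℝ) + 1) with hc₁
  have hc₁0 : 0 ≤ C * c₁ := mul_nonneg hC (by rw [hc₁]; positivity)
  obtain ⟨L'₁, M₁, h1⟩ := hR L u A B₂ hu hB₂1
  -- thresholds
  obtain ⟨N₀, hN₀⟩ := Filter.eventually_atTop.1 ((eventually_inv_logz_le_eta u B₂).and
    ((eventually_lam_term C hC u t Bκ).and ((eventually_R_term (C * c₁) hc₁0 L A₂ t hL1).and
    ((eventually_le_loglog (max 1 (4 * C * 2 ^ κ))).and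
    ((tendsto_natCast_atTop_atTop.eventually_ge_atTop x₀).and ((eventually_ge_atTop M₀).and
    ((eventually_ge_atTop M₁).and ((eventually_ge_atTop 2).and
    ((eventually_eta_le hB₂1 hη₀).and ((eventually_x_rpow_le L B₂ (A₃ + Q) hL1).and
    ((eventually_x_div_z_le L u Q hL1 hu1).and
    ((Real.tendsto_log_atTop.comp tendsto_natCast_atTop_atTop).eventually_ge_atTop
      (max 1 (Real.log (2 * L)))))))))))))))
  refine ⟨N₀, fun N hN Ψ hΨ hL K hK hKN i j' hj' hlt1 hKT hF0 => ?_⟩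
  obtain ⟨hinvz, hlamT, hRT, hll, hx₀N, hNM₀, hNM₁, hN2, hEta, hxη, hxz, hlogN⟩ := hN₀ N hN
  have hN0 : (0 : ℝ) < N := by exact_mod_cast (by omega : 0 < N)
  have hN2r : (2 : ℝ) ≤ N := by exact_mod_cast hN2
  have hℓ1 : (1 : ℝ) ≤ Real.log N := le_trans (le_max_left _ _) hlogN
  have hℓ2L : Real.log (2 * L) ≤ Real.log N := le_trans (le_max_right _ _) hlogN
  have hℓ0 : 0 < Real.log (N : ℝ) := by linarith
  set ℓℓ := Real.log (Real.log (N : ℝ)) with hℓℓ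
  have hℓℓ1 : 1 ≤ ℓℓ := le_trans (le_max_left _ _) hll
  have hℓℓC : 4 * C * 2 ^ κ ≤ ℓℓ := le_trans (le_max_right _ _) hll
  have hpowκ : 0 < ℓℓ ^ Bκ := pow_pos (by linarith) _
  -- `x = 2LN`: size and logarithm
  have hx2 : (2 : ℝ) ≤ xOf L N := by
    change (2 : ℝ) ≤ 2 * (L : ℝ) * N
    nlinarith
  have hx1 : (1 : ℝ) ≤ xOf L N := by linarith
  have hx₀ : x₀ ≤ xOf L N := by
    refine le_trans hx₀N ?_
    change (N : ℝ) ≤ 2 * (L : ℝ) * N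
    nlinarith
  have hlogx : Real.log (xOf L N) ≤ 2 * Real.log N := by
    change Real.log (2 * (L : ℝ) * N) ≤ _
    rw [Real.log_mul (by positivity) hN0.ne']
    linarith
  have hlogx0 : 0 ≤ Real.log (xOf L N) := Real.log_nonneg hx1
  have hη : etaOf N B₂ = 2 / ℓℓ ^ B₂ := rfl
  have hη0' : 0 ≤ etaOf N B₂ := by rw [hη]; exact div_nonneg zero_le_two (pow_nonneg (by linarith) _)
  have hY1 : (1 : ℝ) ≤ Real.log N ^ P := one_le_pow₀ hℓ1
  -- the two instances of the ready sequence
  obtain ⟨-, -, -, -, -, -, -, hIw0, hlow0, -, -, -, -⟩ :=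
    h0 N hNM₀ Ψ hΨ hL K hK hKN i j' hj' hlt1 hKT hF0
  obtain ⟨⟨hz1, hz2, hη1, -, hΛ1, hΛ2, hw1, hw2⟩, hwt, hsHi, hsLo, hsize, -, hdensLe, -, -,
    hTI, hcell, hsizeF, hdens⟩ := h1 N hNM₁ Ψ hΨ hL K hK hKN i j' hj' hlt1 hKT hF0
  -- `z ≤ x^{1/u} ≤ x^{1/2}`
  have hu2 : (2 : ℝ) ≤ u := by exact_mod_cast hu
  have hz2' : zOf N u ≤ xOf L N ^ (1 / 2 : ℝ) :=
    hz2.trans (Real.rpow_le_rpow_of_exponent_le hx1 (one_div_le_one_div_of_le (by norm_num) hu2))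
  -- the strong Type-I bound from the covering inequality on the grid `Y = (log N)^P`
  have hS : StrongTypeI (secSeqB Ψ K N u i j') (xOf L N) (etaOf N B₂)
      ((Real.log N ^ P + 2) * rOf N A +
        Cc * (xOf L N / Real.log N ^ P + xOf L N ^ (1 - etaOf N B₂)) * Real.log (xOf L N) ^ A₃) :=
    hcov (secSeqB Ψ K N u i j') (xOf L N) (etaOf N B₂) (rOf N A) (Real.log N ^ P) hx2 hη0' hY1
      hwt hsize hdensLe hIw0 hTI
  -- the kernel
  obtain ⟨δ, hδ0, hδ2, hlaw⟩ := hKer (secSeqB Ψ K N u i j') (xOf L N) (zOf N u) (etaOf N B₂)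
    (lamOf N t) (wOf N) _ hx₀ hz1 hz2' ⟨hη1, hEta, hΛ1, hΛ2, hw1, hw2⟩
    ⟨hwt, hsHi, hsLo, hsize, hdensLe, hIw0, hlow0, hS⟩
  refine ⟨δ, hδ0, hδ2, fun m hm => ?_⟩
  have hm' := hlaw m hm
  simp only [primeMain, kernelErr] at hm'
  rw [hcell m hm, hsizeF, hdens] at hm'
  -- notation
  set V : ℝ := ∏ p ∈ Nat.primesBelow ⌈zOf N u⌉₊, (1 - sectionDensity Ψ i p) with hV
  set F : ℝ := (sectionMass Ψ K N u i j' 1 : ℝ) with hFdef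
  have hmain : (1 + (δ - 1) * (-1 : ℝ) ^ m) *
        roughCellDensity m (Real.log (xOf L N) / Real.log (zOf N u)) *
        (Real.exp Real.eulerMascheroniConstant * V * F / (Real.log (xOf L N) / Real.log (zOf N u))) =
      (1 + (δ - 1) * (-1 : ℝ) ^ m) *
        (roughCellDensity m (Real.log (xOf L N) / Real.log (zOf N u)) /
          (Real.log (xOf L N) / Real.log (zOf N u))) *
        (Real.exp Real.eulerMascheroniConstant * V) * F := by ring
  rw [hmain] at hm'
  refine hm'.trans ?_
  have hV0 : 0 ≤ V := prod_one_sub_sectionDensity_nonneg Ψ i _ fun p hp => Nat.prime_of_mem_primesBelow hp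
  have hF0' : 0 ≤ F := Nat.cast_nonneg _
  have hVF : 0 ≤ V * F := mul_nonneg hV0 hF0'
  -- the three relative error terms (as in `stub_geThreeReduce`)
  have hlogz : Real.log (zOf N u) = 1 / (u : ℝ) * Real.log N := by
    change Real.log ((N : ℝ) ^ ((1 : ℝ) / u)) = _
    rw [Real.log_rpow hN0]
  have hu0 : (0 : ℝ) < u := by exact_mod_cast (by omega : 0 < u)
  have hlogz0 : 0 < Real.log (zOf N u) := by rw [hlogz]; positivity
  have hηκ : etaOf N B₂ ^ κ ≤ (2 : ℝ) ^ κ / (ℓℓ ^ Bκ * ℓℓ) := by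
    rw [hη]; exact eta_rpow_le hℓℓ1 hBκ
  have hzκ : Real.log (zOf N u) ^ (-κ) ≤ etaOf N B₂ ^ κ :=
    log_rpow_neg_le hlogz0 hκ.le (by rw [hlogz, hη]; exact hinvz)
  have hlam : C * (Real.log (2 * lamOf N t) / Real.log (zOf N u)) ≤ 1 / 2 / ℓℓ ^ Bκ := by
    rw [hlogz]; exact hlamT
  have hrel : C * (etaOf N B₂ ^ κ + Real.log (zOf N u) ^ (-κ) +
      Real.log (2 * lamOf N t) / Real.log (zOf N u)) ≤ 1 / ℓℓ ^ Bκ := by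
    have h2 : C * (etaOf N B₂ ^ κ + Real.log (zOf N u) ^ (-κ)) ≤ 1 / 2 / ℓℓ ^ Bκ := by
      calc C * (etaOf N B₂ ^ κ + Real.log (zOf N u) ^ (-κ))
          ≤ C * (2 * ((2 : ℝ) ^ κ / (ℓℓ ^ Bκ * ℓℓ))) := by
            apply mul_le_mul_of_nonneg_left _ hC; linarith
        _ = (4 * C * 2 ^ κ) / (2 * (ℓℓ ^ Bκ * ℓℓ)) := by ring
        _ ≤ ℓℓ / (2 * (ℓℓ ^ Bκ * ℓℓ)) := by gcongr
        _ = 1 / 2 / ℓℓ ^ Bκ := by field_simp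
    calc C * (etaOf N B₂ ^ κ + Real.log (zOf N u) ^ (-κ) + Real.log (2 * lamOf N t) / Real.log (zOf N u))
        = C * (etaOf N B₂ ^ κ + Real.log (zOf N u) ^ (-κ)) +
            C * (Real.log (2 * lamOf N t) / Real.log (zOf N u)) := by ring
      _ ≤ 1 / 2 / ℓℓ ^ Bκ + 1 / 2 / ℓℓ ^ Bκ := add_le_add h2 hlam
      _ = 1 / ℓℓ ^ Bκ := by ring
  -- the absolute error terms: `R_s + x/z ≤ c₁ N/(log N)^Q`, then `eventually_R_term`
  have hRs : (Real.log N ^ P + 2) * rOf N A +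
        Cc * (xOf L N / Real.log N ^ P + xOf L N ^ (1 - etaOf N B₂)) * Real.log (xOf L N) ^ A₃ +
        xOf L N / zOf N u ≤ c₁ * ((N : ℝ) / Real.log N ^ Q) :=
    strong_R_le (ℓ := Real.log N) (N := (N : ℝ)) (L := (L : ℝ)) hP hAdef rfl hℓ1 hlogx hlogx0 hN0.le
      (Nat.cast_nonneg L) hCc hxη hxz
  have habs : C * Real.log (xOf L N) ^ A₂ * ((Real.log N ^ P + 2) * rOf N A +
        Cc * (xOf L N / Real.log N ^ P + xOf L N ^ (1 - etaOf N B₂)) * Real.log (xOf L N) ^ A₃ +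
        xOf L N / zOf N u) ≤ (N : ℝ) / Real.log N ^ (t + 2) :=
    calc C * Real.log (xOf L N) ^ A₂ * ((Real.log N ^ P + 2) * rOf N A +
          Cc * (xOf L N / Real.log N ^ P + xOf L N ^ (1 - etaOf N B₂)) * Real.log (xOf L N) ^ A₃ +
          xOf L N / zOf N u)
        ≤ C * Real.log (xOf L N) ^ A₂ * (c₁ * ((N : ℝ) / Real.log N ^ Q)) :=
          mul_le_mul_of_nonneg_left hRs (mul_nonneg hC (pow_nonneg hlogx0 _))
      _ = C * c₁ * Real.log (xOf L N) ^ A₂ * ((N : ℝ) / Real.log N ^ Q) := by ring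
      _ ≤ (N : ℝ) / Real.log N ^ (t + 2) := hRT
  -- conclusion
  calc C * (etaOf N B₂ ^ κ + Real.log (zOf N u) ^ (-κ) + Real.log (2 * lamOf N t) / Real.log (zOf N u)) *
          (V * F) + C * Real.log (xOf L N) ^ A₂ * ((Real.log N ^ P + 2) * rOf N A +
          Cc * (xOf L N / Real.log N ^ P + xOf L N ^ (1 - etaOf N B₂)) * Real.log (xOf L N) ^ A₃ +
          xOf L N / zOf N u)
      ≤ 1 / ℓℓ ^ Bκ * (V * F) + (N : ℝ) / Real.log N ^ (t + 2) :=
        add_le_add (mul_le_mul_of_nonneg_right hrel hVF) habs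
    _ = V * F / Real.log (Real.log N) ^ Bκ + (N : ℝ) / Real.log N ^ (t + 2) := by rw [hℓℓ]; ring

end Summit.Parity.GeneralizedHardyLittlewood.Cruxes.CellParityLaw.SectionAnnihilator

end
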